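import Mathlib
import HarnessLib

/-!
# Iterated indefinite integrals: Cauchy's formula for repeated integration
(Davis–Rabinowitz 1984, Sect. 1.11, formula 9)

**Source.** P. J. Davis, P. Rabinowitz, *Methods of Numerical Integration* (2nd ed., Academic Press, 1984),
Sect. 1.11 "Some Useful Formulas", item 9 "Iterated Indefinite Integrals" (p. 28).

**Statement.** For `f` continuous and `n ≥ 1`,
  `∫_a^x dt_n ∫_a^{t_n} dt_{n-1} ⋯ ∫_a^{t_2} f(t_1) dt_1 = (1/(n-1)!) ∫_a^x (x - t)^{n-1} f(t) dt`
  `                                              = ((x-a)^n/(n-1)!) ∫_0^1 t^{n-1} f(x - (x-a)t) dt.`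
We define the `n`-fold iterated indefinite integral `iterIntegral a f n` recursively
(`iterIntegral a f 0 = f`, `iterIntegral a f (n+1) x = ∫_a^x iterIntegral a f n`), prove that it is continuous
(`continuous_iterIntegral`), that iterating commutes with the first integration
(`iterIntegral_succ_eq_iterIntegral_primitive`), Cauchy's formula (`iterIntegral_eq_integral_pow_mul`, first
equality) and the rescaled form over the fixed interval `[0, 1]` (`iterIntegral_eq_pow_mul_integral_unit`, second
equality); the key step is the integration by parts
`∫_a^x (x-t)^n f(t) dt = n ∫_a^x (x-t)^{n-1} (∫_a^t f) dt` (`integral_pow_mul_eq_mul_integral_pow_mul_primitive`).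

**Used by / context.** The formula turns an `n`-fold indefinite integration into ONE integral against the
kernel `(x-t)^{n-1}/(n-1)!` — the device behind the Peano-kernel / Taylor-remainder representations used
throughout Chapter 4 of the text and behind the "remainder as the integral of a spline" of Sect. 2.13.2; it is the
`n ∈ ℕ` case of the Riemann–Liouville integral.

**Proof sketch / formalization notes.** Induction on `n`, generalising over `f`: the `(n+1)`-fold integral of
`f` is the `n`-fold integral of the primitive `F = ∫_a^· f` (which is continuous), and
`(1/(n-1)!) ∫_a^x (x-t)^{n-1} F(t) dt = (1/n!) ∫_a^x (x-t)^n f(t) dt` by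
`intervalIntegral.integral_mul_deriv_eq_deriv_mul` with `u = (x-t)^n`, `v = F` (`F' = f` by
`Continuous.integral_hasStrictDerivAt`).  The `[0, 1]` form is the affine substitution `t ↦ x - (x-a)t`
(`intervalIntegral.integral_comp_sub_mul`), with the degenerate case `x = a` handled separately.  Everything is
over Mathlib's interval integral; no `sorry`, no new axioms.
-/

open Real MeasureTheory intervalIntegral Set

noncomputable section

namespace Literature.Analysis.Quadrature

/-- The `n`-fold iterated indefinite integral based at `a`:
`iterIntegral a f 0 = f`, `iterIntegral a f (n+1) x = ∫_a^x iterIntegral a f n t dt`, i.e.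
`iterIntegral a f n x = ∫_a^x dt_n ∫_a^{t_n} ⋯ ∫_a^{t_2} f(t_1) dt_1`. [cite: DavisRabinowitz1984, Sect. 1.11 (9)] -/
def iterIntegral (a : ℝ) (f : ℝ → ℝ) : ℕ → ℝ → ℝ
  | 0 => f
  | n + 1 => fun x => ∫ t in a..x, iterIntegral a f n t

/-- `iterIntegral a f 0 = f`. [cite: DavisRabinowitz1984, Sect. 1.11 (9)] -/
@[simp] theorem iterIntegral_zero (a : ℝ) (f : ℝ → ℝ) : iterIntegral a f 0 = f := rfl

/-- `iterIntegral a f (n+1) x = ∫_a^x iterIntegral a f n`. [cite: DavisRabinowitz1984, Sect. 1.11 (9)] -/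
theorem iterIntegral_succ (a : ℝ) (f : ℝ → ℝ) (n : ℕ) (x : ℝ) :
    iterIntegral a f (n + 1) x = ∫ t in a..x, iterIntegral a f n t := rfl

/-- The one-fold integral is the primitive `∫_a^x f`. [cite: DavisRabinowitz1984, Sect. 1.11 (9)] -/
theorem iterIntegral_one (a : ℝ) (f : ℝ → ℝ) (x : ℝ) : iterIntegral a f 1 x = ∫ t in a..x, f t := rfl

/-- Every iterated integral vanishes at the base point: `iterIntegral a f (n+1) a = 0`.
[cite: DavisRabinowitz1984, Sect. 1.11 (9)] -/
@[simp] theorem iterIntegral_succ_self (a : ℝ) (f : ℝ → ℝ) (n : ℕ) : iterIntegral a f (n + 1) a = 0 := by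
  simp [iterIntegral_succ]

/-- Iterated integrals of a continuous function are continuous. [cite: DavisRabinowitz1984, Sect. 1.11 (9)] -/
theorem continuous_iterIntegral (a : ℝ) {f : ℝ → ℝ} (hf : Continuous f) (n : ℕ) :
    Continuous (iterIntegral a f n) := by
  induction n with
  | zero => simpa using hf
  | succ n ih =>
    have h : (iterIntegral a f (n + 1)) = fun x => ∫ t in a..x, iterIntegral a f n t := rfl
    rw [h]
    exact intervalIntegral.continuous_primitive (fun _ _ => ih.intervalIntegrable _ _) a

/-- Iterating commutes with the first integration: the `(n+1)`-fold integral of `f` is the `n`-fold integral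
of the primitive `∫_a^· f`. [cite: DavisRabinowitz1984, Sect. 1.11 (9)] -/
theorem iterIntegral_succ_eq_iterIntegral_primitive (a : ℝ) (f : ℝ → ℝ) (n : ℕ) :
    iterIntegral a f (n + 1) = iterIntegral a (iterIntegral a f 1) n := by
  induction n with
  | zero => rfl
  | succ n ih =>
    funext x
    rw [iterIntegral_succ, iterIntegral_succ, ih]

/-- **The integration-by-parts step.** For continuous `f`, `n ≥ 1` and all `a, x`,
`∫_a^x (x-t)^n f(t) dt = n ∫_a^x (x-t)^{n-1} (∫_a^t f) dt`. [cite: DavisRabinowitz1984, Sect. 1.11 (9)] -/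
theorem integral_pow_mul_eq_mul_integral_pow_mul_primitive {f : ℝ → ℝ} (hf : Continuous f) (a x : ℝ)
    {n : ℕ} (hn : n ≠ 0) :
    ∫ t in a..x, (x - t) ^ n * f t = n * ∫ t in a..x, (x - t) ^ (n - 1) * iterIntegral a f 1 t := by
  have hu : ∀ t ∈ uIcc a x, HasDerivAt (fun t : ℝ => (x - t) ^ n) (-(n * (x - t) ^ (n - 1))) t := by
    intro t _
    have h := ((hasDerivAt_id t).const_sub x).pow n
    refine h.congr_deriv ?_
    simp
  have hv : ∀ t ∈ uIcc a x, HasDerivAt (iterIntegral a f 1) (f t) t := fun t _ =>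
    (hf.integral_hasStrictDerivAt a t).hasDerivAt
  have hparts := intervalIntegral.integral_mul_deriv_eq_deriv_mul hu hv
    ((by fun_prop : Continuous fun t : ℝ => -(n * (x - t) ^ (n - 1))).intervalIntegrable a x)
    (hf.intervalIntegrable a x)
  rw [hparts]
  simp only [sub_self, zero_pow hn, zero_mul, iterIntegral_succ_self, mul_zero, zero_sub, neg_mul,
    intervalIntegral.integral_neg, neg_neg]
  rw [← intervalIntegral.integral_const_mul]
  refine intervalIntegral.integral_congr fun t _ => ?_
  ring

/-- **Cauchy's formula for repeated integration** (first equality of Davis–Rabinowitz 1.11 (9)): for continuous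
`f`, `n ≥ 1` and all `a, x`,
`∫_a^x dt_n ∫_a^{t_n} ⋯ ∫_a^{t_2} f(t_1) dt_1 = (1/(n-1)!) ∫_a^x (x-t)^{n-1} f(t) dt`.
[cite: DavisRabinowitz1984, Sect. 1.11 (9)] -/
theorem iterIntegral_eq_integral_pow_mul {f : ℝ → ℝ} (hf : Continuous f) (a : ℝ) {n : ℕ} (hn : n ≠ 0) (x : ℝ) :
    iterIntegral a f n x = 1 / (n - 1).factorial * ∫ t in a..x, (x - t) ^ (n - 1) * f t := by
  induction n generalizing f x with
  | zero => exact absurd rfl hn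
  | succ n ih =>
    rcases Nat.eq_zero_or_pos n with rfl | hpos
    · simp [iterIntegral_one]
    · -- `(n+1)`-fold integral of `f` = `n`-fold integral of the primitive `F`
      rw [iterIntegral_succ_eq_iterIntegral_primitive, show n + 1 - 1 = n from rfl]
      rw [congrFun (funext fun y => ih (continuous_iterIntegral a hf 1) hpos.ne' y) x]
      rw [integral_pow_mul_eq_mul_integral_pow_mul_primitive hf a x hpos.ne']
      -- `1/(n-1)! * (n * I) = 1/n! * ... ` bookkeeping: `n! = n * (n-1)!`
      obtain ⟨m, rfl⟩ : ∃ m, n = m + 1 := ⟨n - 1, (Nat.succ_pred_eq_of_pos hpos).symm⟩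
      simp only [Nat.add_sub_cancel, Nat.factorial_succ, Nat.cast_mul, Nat.cast_add, Nat.cast_one]
      have hm : ((m : ℝ) + 1) ≠ 0 := by positivity
      have hfac : ((m.factorial : ℕ) : ℝ) ≠ 0 := by positivity
      field_simp

/-- **The rescaled form over `[0, 1]`** (second equality of Davis–Rabinowitz 1.11 (9)): for continuous `f`,
`n ≥ 1` and all `a, x`,
`∫_a^x dt_n ⋯ ∫_a^{t_2} f(t_1) dt_1 = ((x-a)^n/(n-1)!) ∫_0^1 t^{n-1} f(x - (x-a)t) dt`.
[cite: DavisRabinowitz1984, Sect. 1.11 (9)] -/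
theorem iterIntegral_eq_pow_mul_integral_unit {f : ℝ → ℝ} (hf : Continuous f) (a : ℝ) {n : ℕ} (hn : n ≠ 0)
    (x : ℝ) :
    iterIntegral a f n x
      = (x - a) ^ n / (n - 1).factorial * ∫ t in (0 : ℝ)..1, t ^ (n - 1) * f (x - (x - a) * t) := by
  rw [iterIntegral_eq_integral_pow_mul hf a hn x]
  rcases eq_or_ne x a with rfl | hxa
  · simp [zero_pow hn]
  have hc : x - a ≠ 0 := sub_ne_zero.mpr hxa
  -- substitute `s = x - (x - a) t` in `∫_0^1 ((x - s)/(x - a))^{n-1} f(s) …`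
  have hsub := intervalIntegral.integral_comp_sub_mul (fun s : ℝ => ((x - s) / (x - a)) ^ (n - 1) * f s) hc x
    (a := 0) (b := 1)
  have hfun : (fun t : ℝ => t ^ (n - 1) * f (x - (x - a) * t))
      = fun t => ((x - (x - (x - a) * t)) / (x - a)) ^ (n - 1) * f (x - (x - a) * t) := by
    funext t
    congr 2
    field_simp
    ring
  rw [hfun, hsub]
  simp only [mul_one, mul_zero, sub_zero, smul_eq_mul]
  rw [show x - (x - a) = a by ring]
  have hpow : ∀ s : ℝ, ((x - s) / (x - a)) ^ (n - 1) * f s = ((x - a) ^ (n - 1))⁻¹ * ((x - s) ^ (n - 1) * f s) := by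
    intro s
    rw [div_pow]
    ring
  simp_rw [hpow, intervalIntegral.integral_const_mul]
  obtain ⟨m, rfl⟩ : ∃ m, n = m + 1 := ⟨n - 1, (Nat.succ_pred_eq_of_pos (Nat.pos_of_ne_zero hn)).symm⟩
  simp only [Nat.add_sub_cancel]
  have hfac : ((m.factorial : ℕ) : ℝ) ≠ 0 := by positivity
  have hpow' : (x - a) ^ m ≠ 0 := pow_ne_zero _ hc
  field_simp
  ring

end Literature.Analysis.Quadrature

end
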